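import Summits.QuantumAdvantage.QuantumAdvantage.Theorems.LinnikCubicClassGroupsDegreeOnePrimesEscapeQuinticS5Group
import HarnessLib

/-!
# The one-sided `S₅`-data for the class `(3,2)`

Topic `Summits/QuantumAdvantage/QuantumAdvantage/Theorems`, cell B2b-1 (linnik-cubic), PART A (gen 8);
helper toward the crux `DegreeOnePrimesEscape` (stmt-QuantumAdvantage-11543) of route
`LinnikCubicClassGroups`.  HONEST FRAMING: the value of this file is a THEOREM (kernel-checked, GRH-free,
Siegel-free, no hypothesis) — NOT summit progress.

The class `(3,2)` of `S₅` is ONE-SIDED: with `C₃ = ⟨(0 1 2)⟩`, `C₅ = ⟨(0 1 2 3 4)⟩`,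
`F₂₀ = AGL(1,5) = ⟨x ↦ x+1, x ↦ 2x⟩`, `S₄ = Stab(0)`, the class function
`1 − Ind_{C₃}1/12 − Ind_{C₅}1/6 − Ind_{F₂₀}1/3 − Ind_{S₄}1/3` vanishes off `{1} ∪ (3,2)` and is `1` on
`(3,2)` (mean `1/12`; found by a small LP).  Normal form (`exists_quintic32_data`):
`12 ≤ Ind_{C₃}1 + 2 Ind_{C₅}1 + 4 Ind_{F₂₀}1 + 4 Ind_{S₄}1 + 12·𝟙[#Fix(y) = 0 ∧ #Fix(y²) = 2]`.
With `exists_frobenius_mem_of_oneSided_symmetric`: **every quintic field all of whose Galois splitting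
fields have degree `≥ 120` has a prime `p ≤ |d_K|^L`, `p ∤ d_K`, with `p𝓞_K = 𝔭₂𝔭₃`**
(`exists_splittingType_two_three_le_of_quintic_S5`).  Only UPPER bounds for four subfields (degrees
`40, 24, 6, 5`) of the Galois closure and the prime number theorem are used.

Placement: existence with explicit exponent from LMO 1979 / Cho–Lemke Oliver–Zaman arXiv:2512.24963
Thm 8; new here is the kernel-checked proof (inexplicit exponent).

References: J. C. Lagarias, H. L. Montgomery, A. M. Odlyzko, Invent. Math. 54 (1979)
[LagariasMontgomeryOdlyzko1979]; R. Perlis, J. Number Theory 9 (1977) [Perlis1977].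
-/

noncomputable section

open Equiv Equiv.Perm

namespace Summit.QuantumAdvantage.QuantumAdvantage.Theorems.DegreeOnePrimesEscape

/-! ### Class functions for a predicate -/

/-- Conjugation counts for a conjugation-stable test are class functions (predicate form). -/
theorem card_filter_conj_of_conj {n : ℕ} (P : Perm (Fin n) → Prop) [DecidablePred P]
    (ρ c : Perm (Fin n)) :
    (Finset.univ.filter fun q : Perm (Fin n) => P (q * (c * ρ * c⁻¹) * q⁻¹)).card =
      (Finset.univ.filter fun q : Perm (Fin n) => P (q * ρ * q⁻¹)).card := by
  refine Finset.card_bij (fun q _ => q * c) ?_ ?_ ?_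
  · intro q hq
    rw [Finset.mem_filter] at hq ⊢
    refine ⟨Finset.mem_univ _, ?_⟩
    have : q * (c * ρ * c⁻¹) * q⁻¹ = q * c * ρ * (q * c)⁻¹ := by group
    rw [← this]; exact hq.2
  · intro q₁ _ q₂ _ h
    exact mul_right_cancel h
  · intro q hq
    rw [Finset.mem_filter] at hq
    refine ⟨q * c⁻¹, ?_, by group⟩
    rw [Finset.mem_filter]
    refine ⟨Finset.mem_univ _, ?_⟩
    have : q * c⁻¹ * (c * ρ * c⁻¹) * (q * c⁻¹)⁻¹ = q * ρ * q⁻¹ := by group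
    rw [this]; exact hq.2

/-! ### The counts at the seven representatives (by `decide`) -/


set_option maxRecDepth 8000 in
/-- Conjugation counts into `C₃, C₅, F₂₀, Stab(0)` and fixed points of `ρ`, `ρ²` at the representative `one`. -/
private theorem counts32_one :
    (Finset.univ.filter fun q : Perm (Fin 5) => q * (1 : Perm (Fin 5)) * q⁻¹ ∈ ({1, Fin.cycleRange (2 : Fin 5), Fin.cycleRange (2 : Fin 5) ^ 2} : Finset (Perm (Fin 5)))).card = 120 ∧
    (Finset.univ.filter fun q : Perm (Fin 5) => q * (1 : Perm (Fin 5)) * q⁻¹ ∈ ({1, finRotate 5, finRotate 5 ^ 2, finRotate 5 ^ 3, finRotate 5 ^ 4} : Finset (Perm (Fin 5)))).card = 120 ∧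
    (Finset.univ.filter fun q : Perm (Fin 5) => q * (1 : Perm (Fin 5)) * q⁻¹ ∈ ({1, finRotate 5, finRotate 5 ^ 2, finRotate 5 ^ 3, finRotate 5 ^ 4, (Equiv.swap (1 : Fin 5) 3 * Equiv.swap (1 : Fin 5) 4 * Equiv.swap (1 : Fin 5) 2), finRotate 5 * (Equiv.swap (1 : Fin 5) 3 * Equiv.swap (1 : Fin 5) 4 * Equiv.swap (1 : Fin 5) 2), finRotate 5 ^ 2 * (Equiv.swap (1 : Fin 5) 3 * Equiv.swap (1 : Fin 5) 4 * Equiv.swap (1 : Fin 5) 2), finRotate 5 ^ 3 * (Equiv.swap (1 : Fin 5) 3 * Equiv.swap (1 : Fin 5) 4 * Equiv.swap (1 : Fin 5) 2), finRotate 5 ^ 4 * (Equiv.swap (1 : Fin 5) 3 * Equiv.swap (1 : Fin 5) 4 * Equiv.swap (1 : Fin 5) 2), (Equiv.swap (1 : Fin 5) 3 * Equiv.swap (1 : Fin 5) 4 * Equiv.swap (1 : Fin 5) 2) ^ 2, finRotate 5 * (Equiv.swap (1 : Fin 5) 3 * Equiv.swap (1 : Fin 5) 4 * Equiv.swap (1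 : Fin 5) 2) ^ 2, finRotate 5 ^ 2 * (Equiv.swap (1 : Fin 5) 3 * Equiv.swap (1 : Fin 5) 4 * Equiv.swap (1 : Fin 5) 2) ^ 2, finRotate 5 ^ 3 * (Equiv.swap (1 : Fin 5) 3 * Equiv.swap (1 : Fin 5) 4 * Equiv.swap (1 : Fin 5) 2) ^ 2, finRotate 5 ^ 4 * (Equiv.swap (1 : Fin 5) 3 * Equiv.swap (1 : Fin 5) 4 * Equiv.swap (1 : Fin 5) 2) ^ 2, (Equiv.swap (1 : Fin 5) 3 * Equiv.swap (1 : Fin 5) 4 * Equiv.swap (1 : Fin 5) 2) ^ 3, finRotate 5 * (Equiv.swap (1 : Fin 5) 3 * Equiv.swap (1 : Fin 5) 4 * Equiv.swap (1 : Fin 5) 2) ^ 3, finRotate 5 ^ 2 * (Equiv.swap (1 : Fin 5) 3 * Equiv.swap (1 : Fin 5) 4 * Equiv.swap (1 : Fin 5) 2) ^ 3, finRotate 5 ^ 3 * (Equiv.swap (1 : Fin 5) 3 * Equiv.swap (1 : Fin 5) 4 * Equiv.swap (1 : Fin 5) 2) ^ 3, finRotate 5 ^ 4 * (Equiv.swap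 (1 : Fin 5) 3 * Equiv.swap (1 : Fin 5) 4 * Equiv.swap (1 : Fin 5) 2) ^ 3} : Finset (Perm (Fin 5)))).card = 120 ∧
    (Finset.univ.filter fun q : Perm (Fin 5) => (q * (1 : Perm (Fin 5)) * q⁻¹) 0 = 0).card = 120 ∧
    (Finset.univ.filter fun i : Fin 5 => ((1 : Perm (Fin 5))) i = i).card = 5 ∧
    (Finset.univ.filter fun i : Fin 5 => ((1 : Perm (Fin 5)) ^ 2) i = i).card = 5 := by
  refine ⟨by decide, by decide, by decide, by decide, by decide, by decide⟩

set_option maxRecDepth 8000 in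
/-- Conjugation counts into `C₃, C₅, F₂₀, Stab(0)` and fixed points of `ρ`, `ρ²` at the representative `r2`. -/
private theorem counts32_r2 :
    (Finset.univ.filter fun q : Perm (Fin 5) => q * Fin.cycleRange (1 : Fin 5) * q⁻¹ ∈ ({1, Fin.cycleRange (2 : Fin 5), Fin.cycleRange (2 : Fin 5) ^ 2} : Finset (Perm (Fin 5)))).card = 0 ∧
    (Finset.univ.filter fun q : Perm (Fin 5) => q * Fin.cycleRange (1 : Fin 5) * q⁻¹ ∈ ({1, finRotate 5, finRotate 5 ^ 2, finRotate 5 ^ 3, finRotate 5 ^ 4} : Finset (Perm (Fin 5)))).card = 0 ∧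
    (Finset.univ.filter fun q : Perm (Fin 5) => q * Fin.cycleRange (1 : Fin 5) * q⁻¹ ∈ ({1, finRotate 5, finRotate 5 ^ 2, finRotate 5 ^ 3, finRotate 5 ^ 4, (Equiv.swap (1 : Fin 5) 3 * Equiv.swap (1 : Fin 5) 4 * Equiv.swap (1 : Fin 5) 2), finRotate 5 * (Equiv.swap (1 : Fin 5) 3 * Equiv.swap (1 : Fin 5) 4 * Equiv.swap (1 : Fin 5) 2), finRotate 5 ^ 2 * (Equiv.swap (1 : Fin 5) 3 * Equiv.swap (1 : Fin 5) 4 * Equiv.swap (1 : Fin 5) 2), finRotate 5 ^ 3 * (Equiv.swap (1 : Fin 5) 3 * Equiv.swap (1 : Fin 5) 4 * Equiv.swap (1 : Fin 5) 2), finRotate 5 ^ 4 * (Equiv.swap (1 : Fin 5) 3 * Equiv.swap (1 : Fin 5) 4 * Equiv.swap (1 : Fin 5) 2), (Equiv.swap (1 : Fin 5) 3 * Equiv.swap (1 : Fin 5) 4 * Equiv.swap (1 : Fin 5) 2) ^ 2, finRotate 5 * (Equiv.swap (1 : Fin 5) 3 * Equiv.swap (1 : Fin 5) 4 * Equiv.swap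 (1 : Fin 5) 2) ^ 2, finRotate 5 ^ 2 * (Equiv.swap (1 : Fin 5) 3 * Equiv.swap (1 : Fin 5) 4 * Equiv.swap (1 : Fin 5) 2) ^ 2, finRotate 5 ^ 3 * (Equiv.swap (1 : Fin 5) 3 * Equiv.swap (1 : Fin 5) 4 * Equiv.swap (1 : Fin 5) 2) ^ 2, finRotate 5 ^ 4 * (Equiv.swap (1 : Fin 5) 3 * Equiv.swap (1 : Fin 5) 4 * Equiv.swap (1 : Fin 5) 2) ^ 2, (Equiv.swap (1 : Fin 5) 3 * Equiv.swap (1 : Fin 5) 4 * Equiv.swap (1 : Fin 5) 2) ^ 3, finRotate 5 * (Equiv.swap (1 : Fin 5) 3 * Equiv.swap (1 : Fin 5) 4 * Equiv.swap (1 : Fin 5) 2) ^ 3, finRotate 5 ^ 2 * (Equiv.swap (1 : Fin 5) 3 * Equiv.swap (1 : Fin 5) 4 * Equiv.swap (1 : Fin 5) 2) ^ 3, finRotate 5 ^ 3 * (Equiv.swap (1 : Fin 5) 3 * Equiv.swap (1 : Fin 5) 4 * Equiv.swap (1 : Fin 5) 2) ^ 3, finRotate 5 ^ 4 * (Equiv.swap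 (1 : Fin 5) 3 * Equiv.swap (1 : Fin 5) 4 * Equiv.swap (1 : Fin 5) 2) ^ 3} : Finset (Perm (Fin 5)))).card = 0 ∧
    (Finset.univ.filter fun q : Perm (Fin 5) => (q * Fin.cycleRange (1 : Fin 5) * q⁻¹) 0 = 0).card = 72 ∧
    (Finset.univ.filter fun i : Fin 5 => (Fin.cycleRange (1 : Fin 5)) i = i).card = 3 ∧
    (Finset.univ.filter fun i : Fin 5 => (Fin.cycleRange (1 : Fin 5) ^ 2) i = i).card = 5 := by
  refine ⟨by decide, by decide, by decide, by decide, by decide, by decide⟩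

set_option maxRecDepth 8000 in
/-- Conjugation counts into `C₃, C₅, F₂₀, Stab(0)` and fixed points of `ρ`, `ρ²` at the representative `r3`. -/
private theorem counts32_r3 :
    (Finset.univ.filter fun q : Perm (Fin 5) => q * Fin.cycleRange (2 : Fin 5) * q⁻¹ ∈ ({1, Fin.cycleRange (2 : Fin 5), Fin.cycleRange (2 : Fin 5) ^ 2} : Finset (Perm (Fin 5)))).card = 12 ∧
    (Finset.univ.filter fun q : Perm (Fin 5) => q * Fin.cycleRange (2 : Fin 5) * q⁻¹ ∈ ({1, finRotate 5, finRotate 5 ^ 2, finRotate 5 ^ 3, finRotate 5 ^ 4} : Finset (Perm (Fin 5)))).card = 0 ∧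
    (Finset.univ.filter fun q : Perm (Fin 5) => q * Fin.cycleRange (2 : Fin 5) * q⁻¹ ∈ ({1, finRotate 5, finRotate 5 ^ 2, finRotate 5 ^ 3, finRotate 5 ^ 4, (Equiv.swap (1 : Fin 5) 3 * Equiv.swap (1 : Fin 5) 4 * Equiv.swap (1 : Fin 5) 2), finRotate 5 * (Equiv.swap (1 : Fin 5) 3 * Equiv.swap (1 : Fin 5) 4 * Equiv.swap (1 : Fin 5) 2), finRotate 5 ^ 2 * (Equiv.swap (1 : Fin 5) 3 * Equiv.swap (1 : Fin 5) 4 * Equiv.swap (1 : Fin 5) 2), finRotate 5 ^ 3 * (Equiv.swap (1 : Fin 5) 3 * Equiv.swap (1 : Fin 5) 4 * Equiv.swap (1 : Fin 5) 2), finRotate 5 ^ 4 * (Equiv.swap (1 : Fin 5) 3 * Equiv.swap (1 : Fin 5) 4 * Equiv.swap (1 : Fin 5) 2), (Equiv.swap (1 : Fin 5) 3 * Equiv.swap (1 : Fin 5) 4 * Equiv.swap (1 : Fin 5) 2) ^ 2, finRotate 5 * (Equiv.swap (1 : Fin 5) 3 * Equiv.swap (1 : Fin 5) 4 * Equiv.swap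 (1 : Fin 5) 2) ^ 2, finRotate 5 ^ 2 * (Equiv.swap (1 : Fin 5) 3 * Equiv.swap (1 : Fin 5) 4 * Equiv.swap (1 : Fin 5) 2) ^ 2, finRotate 5 ^ 3 * (Equiv.swap (1 : Fin 5) 3 * Equiv.swap (1 : Fin 5) 4 * Equiv.swap (1 : Fin 5) 2) ^ 2, finRotate 5 ^ 4 * (Equiv.swap (1 : Fin 5) 3 * Equiv.swap (1 : Fin 5) 4 * Equiv.swap (1 : Fin 5) 2) ^ 2, (Equiv.swap (1 : Fin 5) 3 * Equiv.swap (1 : Fin 5) 4 * Equiv.swap (1 : Fin 5) 2) ^ 3, finRotate 5 * (Equiv.swap (1 : Fin 5) 3 * Equiv.swap (1 : Fin 5) 4 * Equiv.swap (1 : Fin 5) 2) ^ 3, finRotate 5 ^ 2 * (Equiv.swap (1 : Fin 5) 3 * Equiv.swap (1 : Fin 5) 4 * Equiv.swap (1 : Fin 5) 2) ^ 3, finRotate 5 ^ 3 * (Equiv.swap (1 : Fin 5) 3 * Equiv.swap (1 : Fin 5) 4 * Equiv.swap (1 : Fin 5) 2) ^ 3, finRotate 5 ^ 4 * (Equiv.swap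 (1 : Fin 5) 3 * Equiv.swap (1 : Fin 5) 4 * Equiv.swap (1 : Fin 5) 2) ^ 3} : Finset (Perm (Fin 5)))).card = 0 ∧
    (Finset.univ.filter fun q : Perm (Fin 5) => (q * Fin.cycleRange (2 : Fin 5) * q⁻¹) 0 = 0).card = 48 ∧
    (Finset.univ.filter fun i : Fin 5 => (Fin.cycleRange (2 : Fin 5)) i = i).card = 2 ∧
    (Finset.univ.filter fun i : Fin 5 => (Fin.cycleRange (2 : Fin 5) ^ 2) i = i).card = 2 := by
  refine ⟨by decide, by decide, by decide, by decide, by decide, by decide⟩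

set_option maxRecDepth 8000 in
/-- Conjugation counts into `C₃, C₅, F₂₀, Stab(0)` and fixed points of `ρ`, `ρ²` at the representative `r4`. -/
private theorem counts32_r4 :
    (Finset.univ.filter fun q : Perm (Fin 5) => q * Fin.cycleRange (3 : Fin 5) * q⁻¹ ∈ ({1, Fin.cycleRange (2 : Fin 5), Fin.cycleRange (2 : Fin 5) ^ 2} : Finset (Perm (Fin 5)))).card = 0 ∧
    (Finset.univ.filter fun q : Perm (Fin 5) => q * Fin.cycleRange (3 : Fin 5) * q⁻¹ ∈ ({1, finRotate 5, finRotate 5 ^ 2, finRotate 5 ^ 3, finRotate 5 ^ 4} : Finset (Perm (Fin 5)))).card = 0 ∧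
    (Finset.univ.filter fun q : Perm (Fin 5) => q * Fin.cycleRange (3 : Fin 5) * q⁻¹ ∈ ({1, finRotate 5, finRotate 5 ^ 2, finRotate 5 ^ 3, finRotate 5 ^ 4, (Equiv.swap (1 : Fin 5) 3 * Equiv.swap (1 : Fin 5) 4 * Equiv.swap (1 : Fin 5) 2), finRotate 5 * (Equiv.swap (1 : Fin 5) 3 * Equiv.swap (1 : Fin 5) 4 * Equiv.swap (1 : Fin 5) 2), finRotate 5 ^ 2 * (Equiv.swap (1 : Fin 5) 3 * Equiv.swap (1 : Fin 5) 4 * Equiv.swap (1 : Fin 5) 2), finRotate 5 ^ 3 * (Equiv.swap (1 : Fin 5) 3 * Equiv.swap (1 : Fin 5) 4 * Equiv.swap (1 : Fin 5) 2), finRotate 5 ^ 4 * (Equiv.swap (1 : Fin 5) 3 * Equiv.swap (1 : Fin 5) 4 * Equiv.swap (1 : Fin 5) 2), (Equiv.swap (1 : Fin 5) 3 * Equiv.swap (1 : Fin 5) 4 * Equiv.swap (1 : Fin 5) 2) ^ 2, finRotate 5 * (Equiv.swap (1 : Fin 5) 3 * Equiv.swap (1 : Fin 5) 4 * Equiv.swap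 (1 : Fin 5) 2) ^ 2, finRotate 5 ^ 2 * (Equiv.swap (1 : Fin 5) 3 * Equiv.swap (1 : Fin 5) 4 * Equiv.swap (1 : Fin 5) 2) ^ 2, finRotate 5 ^ 3 * (Equiv.swap (1 : Fin 5) 3 * Equiv.swap (1 : Fin 5) 4 * Equiv.swap (1 : Fin 5) 2) ^ 2, finRotate 5 ^ 4 * (Equiv.swap (1 : Fin 5) 3 * Equiv.swap (1 : Fin 5) 4 * Equiv.swap (1 : Fin 5) 2) ^ 2, (Equiv.swap (1 : Fin 5) 3 * Equiv.swap (1 : Fin 5) 4 * Equiv.swap (1 : Fin 5) 2) ^ 3, finRotate 5 * (Equiv.swap (1 : Fin 5) 3 * Equiv.swap (1 : Fin 5) 4 * Equiv.swap (1 : Fin 5) 2) ^ 3, finRotate 5 ^ 2 * (Equiv.swap (1 : Fin 5) 3 * Equiv.swap (1 : Fin 5) 4 * Equiv.swap (1 : Fin 5) 2) ^ 3, finRotate 5 ^ 3 * (Equiv.swap (1 : Fin 5) 3 * Equiv.swap (1 : Fin 5) 4 * Equiv.swap (1 : Fin 5) 2) ^ 3, finRotate 5 ^ 4 * (Equiv.swap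 (1 : Fin 5) 3 * Equiv.swap (1 : Fin 5) 4 * Equiv.swap (1 : Fin 5) 2) ^ 3} : Finset (Perm (Fin 5)))).card = 40 ∧
    (Finset.univ.filter fun q : Perm (Fin 5) => (q * Fin.cycleRange (3 : Fin 5) * q⁻¹) 0 = 0).card = 24 ∧
    (Finset.univ.filter fun i : Fin 5 => (Fin.cycleRange (3 : Fin 5)) i = i).card = 1 ∧
    (Finset.univ.filter fun i : Fin 5 => (Fin.cycleRange (3 : Fin 5) ^ 2) i = i).card = 1 := by
  refine ⟨by decide, by decide, by decide, by decide, by decide, by decide⟩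

set_option maxRecDepth 8000 in
/-- Conjugation counts into `C₃, C₅, F₂₀, Stab(0)` and fixed points of `ρ`, `ρ²` at the representative `r5`. -/
private theorem counts32_r5 :
    (Finset.univ.filter fun q : Perm (Fin 5) => q * Fin.cycleRange (4 : Fin 5) * q⁻¹ ∈ ({1, Fin.cycleRange (2 : Fin 5), Fin.cycleRange (2 : Fin 5) ^ 2} : Finset (Perm (Fin 5)))).card = 0 ∧
    (Finset.univ.filter fun q : Perm (Fin 5) => q * Fin.cycleRange (4 : Fin 5) * q⁻¹ ∈ ({1, finRotate 5, finRotate 5 ^ 2, finRotate 5 ^ 3, finRotate 5 ^ 4} : Finset (Perm (Fin 5)))).card = 20 ∧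
    (Finset.univ.filter fun q : Perm (Fin 5) => q * Fin.cycleRange (4 : Fin 5) * q⁻¹ ∈ ({1, finRotate 5, finRotate 5 ^ 2, finRotate 5 ^ 3, finRotate 5 ^ 4, (Equiv.swap (1 : Fin 5) 3 * Equiv.swap (1 : Fin 5) 4 * Equiv.swap (1 : Fin 5) 2), finRotate 5 * (Equiv.swap (1 : Fin 5) 3 * Equiv.swap (1 : Fin 5) 4 * Equiv.swap (1 : Fin 5) 2), finRotate 5 ^ 2 * (Equiv.swap (1 : Fin 5) 3 * Equiv.swap (1 : Fin 5) 4 * Equiv.swap (1 : Fin 5) 2), finRotate 5 ^ 3 * (Equiv.swap (1 : Fin 5) 3 * Equiv.swap (1 : Fin 5) 4 * Equiv.swap (1 : Fin 5) 2), finRotate 5 ^ 4 * (Equiv.swap (1 : Fin 5) 3 * Equiv.swap (1 : Fin 5) 4 * Equiv.swap (1 : Fin 5) 2), (Equiv.swap (1 : Fin 5) 3 * Equiv.swap (1 : Fin 5) 4 * Equiv.swap (1 : Fin 5) 2) ^ 2, finRotate 5 * (Equiv.swap (1 : Fin 5) 3 * Equiv.swap (1 : Fin 5) 4 * Equiv.swap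 (1 : Fin 5) 2) ^ 2, finRotate 5 ^ 2 * (Equiv.swap (1 : Fin 5) 3 * Equiv.swap (1 : Fin 5) 4 * Equiv.swap (1 : Fin 5) 2) ^ 2, finRotate 5 ^ 3 * (Equiv.swap (1 : Fin 5) 3 * Equiv.swap (1 : Fin 5) 4 * Equiv.swap (1 : Fin 5) 2) ^ 2, finRotate 5 ^ 4 * (Equiv.swap (1 : Fin 5) 3 * Equiv.swap (1 : Fin 5) 4 * Equiv.swap (1 : Fin 5) 2) ^ 2, (Equiv.swap (1 : Fin 5) 3 * Equiv.swap (1 : Fin 5) 4 * Equiv.swap (1 : Fin 5) 2) ^ 3, finRotate 5 * (Equiv.swap (1 : Fin 5) 3 * Equiv.swap (1 : Fin 5) 4 * Equiv.swap (1 : Fin 5) 2) ^ 3, finRotate 5 ^ 2 * (Equiv.swap (1 : Fin 5) 3 * Equiv.swap (1 : Fin 5) 4 * Equiv.swap (1 : Fin 5) 2) ^ 3, finRotate 5 ^ 3 * (Equiv.swap (1 : Fin 5) 3 * Equiv.swap (1 : Fin 5) 4 * Equiv.swap (1 : Fin 5) 2) ^ 3, finRotate 5 ^ 4 * (Equiv.swap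 (1 : Fin 5) 3 * Equiv.swap (1 : Fin 5) 4 * Equiv.swap (1 : Fin 5) 2) ^ 3} : Finset (Perm (Fin 5)))).card = 20 ∧
    (Finset.univ.filter fun q : Perm (Fin 5) => (q * Fin.cycleRange (4 : Fin 5) * q⁻¹) 0 = 0).card = 0 ∧
    (Finset.univ.filter fun i : Fin 5 => (Fin.cycleRange (4 : Fin 5)) i = i).card = 0 ∧
    (Finset.univ.filter fun i : Fin 5 => (Fin.cycleRange (4 : Fin 5) ^ 2) i = i).card = 0 := by
  refine ⟨by decide, by decide, by decide, by decide, by decide, by decide⟩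

set_option maxRecDepth 8000 in
/-- Conjugation counts into `C₃, C₅, F₂₀, Stab(0)` and fixed points of `ρ`, `ρ²` at the representative `r22`. -/
private theorem counts32_r22 :
    (Finset.univ.filter fun q : Perm (Fin 5) => q * (Fin.cycleRange (1 : Fin 5) * Equiv.swap (3 : Fin 5) 4) * q⁻¹ ∈ ({1, Fin.cycleRange (2 : Fin 5), Fin.cycleRange (2 : Fin 5) ^ 2} : Finset (Perm (Fin 5)))).card = 0 ∧
    (Finset.univ.filter fun q : Perm (Fin 5) => q * (Fin.cycleRange (1 : Fin 5) * Equiv.swap (3 : Fin 5) 4) * q⁻¹ ∈ ({1, finRotate 5, finRotate 5 ^ 2, finRotate 5 ^ 3, finRotate 5 ^ 4} : Finset (Perm (Fin 5)))).card = 0 ∧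
    (Finset.univ.filter fun q : Perm (Fin 5) => q * (Fin.cycleRange (1 : Fin 5) * Equiv.swap (3 : Fin 5) 4) * q⁻¹ ∈ ({1, finRotate 5, finRotate 5 ^ 2, finRotate 5 ^ 3, finRotate 5 ^ 4, (Equiv.swap (1 : Fin 5) 3 * Equiv.swap (1 : Fin 5) 4 * Equiv.swap (1 : Fin 5) 2), finRotate 5 * (Equiv.swap (1 : Fin 5) 3 * Equiv.swap (1 : Fin 5) 4 * Equiv.swap (1 : Fin 5) 2), finRotate 5 ^ 2 * (Equiv.swap (1 : Fin 5) 3 * Equiv.swap (1 : Fin 5) 4 * Equiv.swap (1 : Fin 5) 2), finRotate 5 ^ 3 * (Equiv.swap (1 : Fin 5) 3 * Equiv.swap (1 : Fin 5) 4 * Equiv.swap (1 : Fin 5) 2), finRotate 5 ^ 4 * (Equiv.swap (1 : Fin 5) 3 * Equiv.swap (1 : Fin 5) 4 * Equiv.swap (1 : Fin 5) 2), (Equiv.swap (1 : Fin 5) 3 * Equiv.swap (1 : Fin 5) 4 * Equiv.swap (1 : Fin 5) 2) ^ 2, finRotate 5 * (Equiv.swap (1 : Fin 5) 3 * Equiv.swap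 (1 : Fin 5) 4 * Equiv.swap (1 : Fin 5) 2) ^ 2, finRotate 5 ^ 2 * (Equiv.swap (1 : Fin 5) 3 * Equiv.swap (1 : Fin 5) 4 * Equiv.swap (1 : Fin 5) 2) ^ 2, finRotate 5 ^ 3 * (Equiv.swap (1 : Fin 5) 3 * Equiv.swap (1 : Fin 5) 4 * Equiv.swap (1 : Fin 5) 2) ^ 2, finRotate 5 ^ 4 * (Equiv.swap (1 : Fin 5) 3 * Equiv.swap (1 : Fin 5) 4 * Equiv.swap (1 : Fin 5) 2) ^ 2, (Equiv.swap (1 : Fin 5) 3 * Equiv.swap (1 : Fin 5) 4 * Equiv.swap (1 : Fin 5) 2) ^ 3, finRotate 5 * (Equiv.swap (1 : Fin 5) 3 * Equiv.swap (1 : Fin 5) 4 * Equiv.swap (1 : Fin 5) 2) ^ 3, finRotate 5 ^ 2 * (Equiv.swap (1 : Fin 5) 3 * Equiv.swap (1 : Fin 5) 4 * Equiv.swap (1 : Fin 5) 2) ^ 3, finRotate 5 ^ 3 * (Equiv.swap (1 : Fin 5) 3 * Equiv.swap (1 : Fin 5) 4 * Equiv.swap (1 : Fin 5) 2) ^ 3,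 finRotate 5 ^ 4 * (Equiv.swap (1 : Fin 5) 3 * Equiv.swap (1 : Fin 5) 4 * Equiv.swap (1 : Fin 5) 2) ^ 3} : Finset (Perm (Fin 5)))).card = 40 ∧
    (Finset.univ.filter fun q : Perm (Fin 5) => (q * (Fin.cycleRange (1 : Fin 5) * Equiv.swap (3 : Fin 5) 4) * q⁻¹) 0 = 0).card = 24 ∧
    (Finset.univ.filter fun i : Fin 5 => ((Fin.cycleRange (1 : Fin 5) * Equiv.swap (3 : Fin 5) 4)) i = i).card = 1 ∧
    (Finset.univ.filter fun i : Fin 5 => ((Fin.cycleRange (1 : Fin 5) * Equiv.swap (3 : Fin 5) 4) ^ 2) i = i).card = 5 := by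
  refine ⟨by decide, by decide, by decide, by decide, by decide, by decide⟩

set_option maxRecDepth 8000 in
/-- Conjugation counts into `C₃, C₅, F₂₀, Stab(0)` and fixed points of `ρ`, `ρ²` at the representative `r32`. -/
private theorem counts32_r32 :
    (Finset.univ.filter fun q : Perm (Fin 5) => q * (Fin.cycleRange (2 : Fin 5) * Equiv.swap (3 : Fin 5) 4) * q⁻¹ ∈ ({1, Fin.cycleRange (2 : Fin 5), Fin.cycleRange (2 : Fin 5) ^ 2} : Finset (Perm (Fin 5)))).card = 0 ∧
    (Finset.univ.filter fun q : Perm (Fin 5) => q * (Fin.cycleRange (2 : Fin 5) * Equiv.swap (3 : Fin 5) 4) * q⁻¹ ∈ ({1, finRotate 5, finRotate 5 ^ 2, finRotate 5 ^ 3, finRotate 5 ^ 4} : Finset (Perm (Fin 5)))).card = 0 ∧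
    (Finset.univ.filter fun q : Perm (Fin 5) => q * (Fin.cycleRange (2 : Fin 5) * Equiv.swap (3 : Fin 5) 4) * q⁻¹ ∈ ({1, finRotate 5, finRotate 5 ^ 2, finRotate 5 ^ 3, finRotate 5 ^ 4, (Equiv.swap (1 : Fin 5) 3 * Equiv.swap (1 : Fin 5) 4 * Equiv.swap (1 : Fin 5) 2), finRotate 5 * (Equiv.swap (1 : Fin 5) 3 * Equiv.swap (1 : Fin 5) 4 * Equiv.swap (1 : Fin 5) 2), finRotate 5 ^ 2 * (Equiv.swap (1 : Fin 5) 3 * Equiv.swap (1 : Fin 5) 4 * Equiv.swap (1 : Fin 5) 2), finRotate 5 ^ 3 * (Equiv.swap (1 : Fin 5) 3 * Equiv.swap (1 : Fin 5) 4 * Equiv.swap (1 : Fin 5) 2), finRotate 5 ^ 4 * (Equiv.swap (1 : Fin 5) 3 * Equiv.swap (1 : Fin 5) 4 * Equiv.swap (1 : Fin 5) 2), (Equiv.swap (1 : Fin 5) 3 * Equiv.swap (1 : Fin 5) 4 * Equiv.swap (1 : Fin 5) 2) ^ 2, finRotate 5 * (Equiv.swap (1 : Fin 5) 3 * Equiv.swap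 (1 : Fin 5) 4 * Equiv.swap (1 : Fin 5) 2) ^ 2, finRotate 5 ^ 2 * (Equiv.swap (1 : Fin 5) 3 * Equiv.swap (1 : Fin 5) 4 * Equiv.swap (1 : Fin 5) 2) ^ 2, finRotate 5 ^ 3 * (Equiv.swap (1 : Fin 5) 3 * Equiv.swap (1 : Fin 5) 4 * Equiv.swap (1 : Fin 5) 2) ^ 2, finRotate 5 ^ 4 * (Equiv.swap (1 : Fin 5) 3 * Equiv.swap (1 : Fin 5) 4 * Equiv.swap (1 : Fin 5) 2) ^ 2, (Equiv.swap (1 : Fin 5) 3 * Equiv.swap (1 : Fin 5) 4 * Equiv.swap (1 : Fin 5) 2) ^ 3, finRotate 5 * (Equiv.swap (1 : Fin 5) 3 * Equiv.swap (1 : Fin 5) 4 * Equiv.swap (1 : Fin 5) 2) ^ 3, finRotate 5 ^ 2 * (Equiv.swap (1 : Fin 5) 3 * Equiv.swap (1 : Fin 5) 4 * Equiv.swap (1 : Fin 5) 2) ^ 3, finRotate 5 ^ 3 * (Equiv.swap (1 : Fin 5) 3 * Equiv.swap (1 : Fin 5) 4 * Equiv.swap (1 : Fin 5) 2) ^ 3,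 finRotate 5 ^ 4 * (Equiv.swap (1 : Fin 5) 3 * Equiv.swap (1 : Fin 5) 4 * Equiv.swap (1 : Fin 5) 2) ^ 3} : Finset (Perm (Fin 5)))).card = 0 ∧
    (Finset.univ.filter fun q : Perm (Fin 5) => (q * (Fin.cycleRange (2 : Fin 5) * Equiv.swap (3 : Fin 5) 4) * q⁻¹) 0 = 0).card = 0 ∧
    (Finset.univ.filter fun i : Fin 5 => ((Fin.cycleRange (2 : Fin 5) * Equiv.swap (3 : Fin 5) 4)) i = i).card = 0 ∧
    (Finset.univ.filter fun i : Fin 5 => ((Fin.cycleRange (2 : Fin 5) * Equiv.swap (3 : Fin 5) 4) ^ 2) i = i).card = 2 := by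
  refine ⟨by decide, by decide, by decide, by decide, by decide, by decide⟩

set_option maxRecDepth 8000 in
/-- `C3` is closed under the group operations and has `3` elements (by `decide`). -/
private theorem closed32_C3 :
    (1 : Perm (Fin 5)) ∈ ({1, Fin.cycleRange (2 : Fin 5), Fin.cycleRange (2 : Fin 5) ^ 2} : Finset (Perm (Fin 5))) ∧ (∀ a ∈ ({1, Fin.cycleRange (2 : Fin 5), Fin.cycleRange (2 : Fin 5) ^ 2} : Finset (Perm (Fin 5))), ∀ b ∈ ({1, Fin.cycleRange (2 : Fin 5), Fin.cycleRange (2 : Fin 5) ^ 2} : Finset (Perm (Fin 5))), a * b ∈ ({1, Fin.cycleRange (2 : Fin 5), Fin.cycleRange (2 : Fin 5) ^ 2} : Finset (Perm (Fin 5)))) ∧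
    (∀ a ∈ ({1, Fin.cycleRange (2 : Fin 5), Fin.cycleRange (2 : Fin 5) ^ 2} : Finset (Perm (Fin 5))), a⁻¹ ∈ ({1, Fin.cycleRange (2 : Fin 5), Fin.cycleRange (2 : Fin 5) ^ 2} : Finset (Perm (Fin 5)))) ∧ (({1, Fin.cycleRange (2 : Fin 5), Fin.cycleRange (2 : Fin 5) ^ 2} : Finset (Perm (Fin 5)))).card = 3 := by
  refine ⟨by decide, by decide, by decide, by decide⟩

set_option maxRecDepth 8000 in
/-- `C5` is closed under the group operations and has `5` elements (by `decide`). -/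
private theorem closed32_C5 :
    (1 : Perm (Fin 5)) ∈ ({1, finRotate 5, finRotate 5 ^ 2, finRotate 5 ^ 3, finRotate 5 ^ 4} : Finset (Perm (Fin 5))) ∧ (∀ a ∈ ({1, finRotate 5, finRotate 5 ^ 2, finRotate 5 ^ 3, finRotate 5 ^ 4} : Finset (Perm (Fin 5))), ∀ b ∈ ({1, finRotate 5, finRotate 5 ^ 2, finRotate 5 ^ 3, finRotate 5 ^ 4} : Finset (Perm (Fin 5))), a * b ∈ ({1, finRotate 5, finRotate 5 ^ 2, finRotate 5 ^ 3, finRotate 5 ^ 4} : Finset (Perm (Fin 5)))) ∧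
    (∀ a ∈ ({1, finRotate 5, finRotate 5 ^ 2, finRotate 5 ^ 3, finRotate 5 ^ 4} : Finset (Perm (Fin 5))), a⁻¹ ∈ ({1, finRotate 5, finRotate 5 ^ 2, finRotate 5 ^ 3, finRotate 5 ^ 4} : Finset (Perm (Fin 5)))) ∧ (({1, finRotate 5, finRotate 5 ^ 2, finRotate 5 ^ 3, finRotate 5 ^ 4} : Finset (Perm (Fin 5)))).card = 5 := by
  refine ⟨by decide, by decide, by decide, by decide⟩

set_option maxRecDepth 8000 in
set_option maxHeartbeats 1600000 in
/-- `F20` is closed under the group operations and has `20` elements (by `decide`). -/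
private theorem closed32_F20 :
    (1 : Perm (Fin 5)) ∈ ({1, finRotate 5, finRotate 5 ^ 2, finRotate 5 ^ 3, finRotate 5 ^ 4, (Equiv.swap (1 : Fin 5) 3 * Equiv.swap (1 : Fin 5) 4 * Equiv.swap (1 : Fin 5) 2), finRotate 5 * (Equiv.swap (1 : Fin 5) 3 * Equiv.swap (1 : Fin 5) 4 * Equiv.swap (1 : Fin 5) 2), finRotate 5 ^ 2 * (Equiv.swap (1 : Fin 5) 3 * Equiv.swap (1 : Fin 5) 4 * Equiv.swap (1 : Fin 5) 2), finRotate 5 ^ 3 * (Equiv.swap (1 : Fin 5) 3 * Equiv.swap (1 : Fin 5) 4 * Equiv.swap (1 : Fin 5) 2), finRotate 5 ^ 4 * (Equiv.swap (1 : Fin 5) 3 * Equiv.swap (1 : Fin 5) 4 * Equiv.swap (1 : Fin 5) 2), (Equiv.swap (1 : Fin 5) 3 * Equiv.swap (1 : Fin 5) 4 * Equiv.swap (1 : Fin 5) 2) ^ 2, finRotate 5 * (Equiv.swap (1 : Fin 5) 3 * Equiv.swap (1 : Fin 5) 4 * Equiv.swap (1 : Fin 5) 2) ^ 2, finRotate 5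 ^ 2 * (Equiv.swap (1 : Fin 5) 3 * Equiv.swap (1 : Fin 5) 4 * Equiv.swap (1 : Fin 5) 2) ^ 2, finRotate 5 ^ 3 * (Equiv.swap (1 : Fin 5) 3 * Equiv.swap (1 : Fin 5) 4 * Equiv.swap (1 : Fin 5) 2) ^ 2, finRotate 5 ^ 4 * (Equiv.swap (1 : Fin 5) 3 * Equiv.swap (1 : Fin 5) 4 * Equiv.swap (1 : Fin 5) 2) ^ 2, (Equiv.swap (1 : Fin 5) 3 * Equiv.swap (1 : Fin 5) 4 * Equiv.swap (1 : Fin 5) 2) ^ 3, finRotate 5 * (Equiv.swap (1 : Fin 5) 3 * Equiv.swap (1 : Fin 5) 4 * Equiv.swap (1 : Fin 5) 2) ^ 3, finRotate 5 ^ 2 * (Equiv.swap (1 : Fin 5) 3 * Equiv.swap (1 : Fin 5) 4 * Equiv.swap (1 : Fin 5) 2) ^ 3, finRotate 5 ^ 3 * (Equiv.swap (1 : Fin 5) 3 * Equiv.swap (1 : Fin 5) 4 * Equiv.swap (1 : Fin 5) 2) ^ 3, finRotate 5 ^ 4 * (Equiv.swap (1 : Fin 5) 3 * Equiv.swap (1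 : Fin 5) 4 * Equiv.swap (1 : Fin 5) 2) ^ 3} : Finset (Perm (Fin 5))) ∧ (∀ a ∈ ({1, finRotate 5, finRotate 5 ^ 2, finRotate 5 ^ 3, finRotate 5 ^ 4, (Equiv.swap (1 : Fin 5) 3 * Equiv.swap (1 : Fin 5) 4 * Equiv.swap (1 : Fin 5) 2), finRotate 5 * (Equiv.swap (1 : Fin 5) 3 * Equiv.swap (1 : Fin 5) 4 * Equiv.swap (1 : Fin 5) 2), finRotate 5 ^ 2 * (Equiv.swap (1 : Fin 5) 3 * Equiv.swap (1 : Fin 5) 4 * Equiv.swap (1 : Fin 5) 2), finRotate 5 ^ 3 * (Equiv.swap (1 : Fin 5) 3 * Equiv.swap (1 : Fin 5) 4 * Equiv.swap (1 : Fin 5) 2), finRotate 5 ^ 4 * (Equiv.swap (1 : Fin 5) 3 * Equiv.swap (1 : Fin 5) 4 * Equiv.swap (1 : Fin 5) 2), (Equiv.swap (1 : Fin 5) 3 * Equiv.swap (1 : Fin 5) 4 * Equiv.swap (1 : Fin 5) 2) ^ 2, finRotate 5 * (Equiv.swap (1 : Fin 5) 3 * Equiv.swap (1 : Fin 5) 4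 * Equiv.swap (1 : Fin 5) 2) ^ 2, finRotate 5 ^ 2 * (Equiv.swap (1 : Fin 5) 3 * Equiv.swap (1 : Fin 5) 4 * Equiv.swap (1 : Fin 5) 2) ^ 2, finRotate 5 ^ 3 * (Equiv.swap (1 : Fin 5) 3 * Equiv.swap (1 : Fin 5) 4 * Equiv.swap (1 : Fin 5) 2) ^ 2, finRotate 5 ^ 4 * (Equiv.swap (1 : Fin 5) 3 * Equiv.swap (1 : Fin 5) 4 * Equiv.swap (1 : Fin 5) 2) ^ 2, (Equiv.swap (1 : Fin 5) 3 * Equiv.swap (1 : Fin 5) 4 * Equiv.swap (1 : Fin 5) 2) ^ 3, finRotate 5 * (Equiv.swap (1 : Fin 5) 3 * Equiv.swap (1 : Fin 5) 4 * Equiv.swap (1 : Fin 5) 2) ^ 3, finRotate 5 ^ 2 * (Equiv.swap (1 : Fin 5) 3 * Equiv.swap (1 : Fin 5) 4 * Equiv.swap (1 : Fin 5) 2) ^ 3, finRotate 5 ^ 3 * (Equiv.swap (1 : Fin 5) 3 * Equiv.swap (1 : Fin 5) 4 * Equiv.swap (1 : Fin 5) 2) ^ 3, finRotate 5 ^ 4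 * (Equiv.swap (1 : Fin 5) 3 * Equiv.swap (1 : Fin 5) 4 * Equiv.swap (1 : Fin 5) 2) ^ 3} : Finset (Perm (Fin 5))), ∀ b ∈ ({1, finRotate 5, finRotate 5 ^ 2, finRotate 5 ^ 3, finRotate 5 ^ 4, (Equiv.swap (1 : Fin 5) 3 * Equiv.swap (1 : Fin 5) 4 * Equiv.swap (1 : Fin 5) 2), finRotate 5 * (Equiv.swap (1 : Fin 5) 3 * Equiv.swap (1 : Fin 5) 4 * Equiv.swap (1 : Fin 5) 2), finRotate 5 ^ 2 * (Equiv.swap (1 : Fin 5) 3 * Equiv.swap (1 : Fin 5) 4 * Equiv.swap (1 : Fin 5) 2), finRotate 5 ^ 3 * (Equiv.swap (1 : Fin 5) 3 * Equiv.swap (1 : Fin 5) 4 * Equiv.swap (1 : Fin 5) 2), finRotate 5 ^ 4 * (Equiv.swap (1 : Fin 5) 3 * Equiv.swap (1 : Fin 5) 4 * Equiv.swap (1 : Fin 5) 2), (Equiv.swap (1 : Fin 5) 3 * Equiv.swap (1 : Fin 5) 4 * Equiv.swap (1 : Fin 5) 2) ^ 2, finRotate 5 * (Equiv.swap (1 :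 Fin 5) 3 * Equiv.swap (1 : Fin 5) 4 * Equiv.swap (1 : Fin 5) 2) ^ 2, finRotate 5 ^ 2 * (Equiv.swap (1 : Fin 5) 3 * Equiv.swap (1 : Fin 5) 4 * Equiv.swap (1 : Fin 5) 2) ^ 2, finRotate 5 ^ 3 * (Equiv.swap (1 : Fin 5) 3 * Equiv.swap (1 : Fin 5) 4 * Equiv.swap (1 : Fin 5) 2) ^ 2, finRotate 5 ^ 4 * (Equiv.swap (1 : Fin 5) 3 * Equiv.swap (1 : Fin 5) 4 * Equiv.swap (1 : Fin 5) 2) ^ 2, (Equiv.swap (1 : Fin 5) 3 * Equiv.swap (1 : Fin 5) 4 * Equiv.swap (1 : Fin 5) 2) ^ 3, finRotate 5 * (Equiv.swap (1 : Fin 5) 3 * Equiv.swap (1 : Fin 5) 4 * Equiv.swap (1 : Fin 5) 2) ^ 3, finRotate 5 ^ 2 * (Equiv.swap (1 : Fin 5) 3 * Equiv.swap (1 : Fin 5) 4 * Equiv.swap (1 : Fin 5) 2) ^ 3, finRotate 5 ^ 3 * (Equiv.swap (1 : Fin 5) 3 * Equiv.swap (1 : Fin 5) 4 * Equiv.swap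 (1 : Fin 5) 2) ^ 3, finRotate 5 ^ 4 * (Equiv.swap (1 : Fin 5) 3 * Equiv.swap (1 : Fin 5) 4 * Equiv.swap (1 : Fin 5) 2) ^ 3} : Finset (Perm (Fin 5))), a * b ∈ ({1, finRotate 5, finRotate 5 ^ 2, finRotate 5 ^ 3, finRotate 5 ^ 4, (Equiv.swap (1 : Fin 5) 3 * Equiv.swap (1 : Fin 5) 4 * Equiv.swap (1 : Fin 5) 2), finRotate 5 * (Equiv.swap (1 : Fin 5) 3 * Equiv.swap (1 : Fin 5) 4 * Equiv.swap (1 : Fin 5) 2), finRotate 5 ^ 2 * (Equiv.swap (1 : Fin 5) 3 * Equiv.swap (1 : Fin 5) 4 * Equiv.swap (1 : Fin 5) 2), finRotate 5 ^ 3 * (Equiv.swap (1 : Fin 5) 3 * Equiv.swap (1 : Fin 5) 4 * Equiv.swap (1 : Fin 5) 2), finRotate 5 ^ 4 * (Equiv.swap (1 : Fin 5) 3 * Equiv.swap (1 : Fin 5) 4 * Equiv.swap (1 : Fin 5) 2), (Equiv.swap (1 : Fin 5) 3 * Equiv.swap (1 : Fin 5) 4 * Equiv.swap (1 : Fin 5)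 2) ^ 2, finRotate 5 * (Equiv.swap (1 : Fin 5) 3 * Equiv.swap (1 : Fin 5) 4 * Equiv.swap (1 : Fin 5) 2) ^ 2, finRotate 5 ^ 2 * (Equiv.swap (1 : Fin 5) 3 * Equiv.swap (1 : Fin 5) 4 * Equiv.swap (1 : Fin 5) 2) ^ 2, finRotate 5 ^ 3 * (Equiv.swap (1 : Fin 5) 3 * Equiv.swap (1 : Fin 5) 4 * Equiv.swap (1 : Fin 5) 2) ^ 2, finRotate 5 ^ 4 * (Equiv.swap (1 : Fin 5) 3 * Equiv.swap (1 : Fin 5) 4 * Equiv.swap (1 : Fin 5) 2) ^ 2, (Equiv.swap (1 : Fin 5) 3 * Equiv.swap (1 : Fin 5) 4 * Equiv.swap (1 : Fin 5) 2) ^ 3, finRotate 5 * (Equiv.swap (1 : Fin 5) 3 * Equiv.swap (1 : Fin 5) 4 * Equiv.swap (1 : Fin 5) 2) ^ 3, finRotate 5 ^ 2 * (Equiv.swap (1 : Fin 5) 3 * Equiv.swap (1 : Fin 5) 4 * Equiv.swap (1 : Fin 5) 2) ^ 3, finRotate 5 ^ 3 * (Equiv.swap (1 : Fin 5) 3 *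 Equiv.swap (1 : Fin 5) 4 * Equiv.swap (1 : Fin 5) 2) ^ 3, finRotate 5 ^ 4 * (Equiv.swap (1 : Fin 5) 3 * Equiv.swap (1 : Fin 5) 4 * Equiv.swap (1 : Fin 5) 2) ^ 3} : Finset (Perm (Fin 5)))) ∧
    (∀ a ∈ ({1, finRotate 5, finRotate 5 ^ 2, finRotate 5 ^ 3, finRotate 5 ^ 4, (Equiv.swap (1 : Fin 5) 3 * Equiv.swap (1 : Fin 5) 4 * Equiv.swap (1 : Fin 5) 2), finRotate 5 * (Equiv.swap (1 : Fin 5) 3 * Equiv.swap (1 : Fin 5) 4 * Equiv.swap (1 : Fin 5) 2), finRotate 5 ^ 2 * (Equiv.swap (1 : Fin 5) 3 * Equiv.swap (1 : Fin 5) 4 * Equiv.swap (1 : Fin 5) 2), finRotate 5 ^ 3 * (Equiv.swap (1 : Fin 5) 3 * Equiv.swap (1 : Fin 5) 4 * Equiv.swap (1 : Fin 5) 2), finRotate 5 ^ 4 * (Equiv.swap (1 : Fin 5) 3 * Equiv.swap (1 : Fin 5) 4 * Equiv.swap (1 : Fin 5) 2), (Equiv.swap (1 : Fin 5) 3 * Equiv.swap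 (1 : Fin 5) 4 * Equiv.swap (1 : Fin 5) 2) ^ 2, finRotate 5 * (Equiv.swap (1 : Fin 5) 3 * Equiv.swap (1 : Fin 5) 4 * Equiv.swap (1 : Fin 5) 2) ^ 2, finRotate 5 ^ 2 * (Equiv.swap (1 : Fin 5) 3 * Equiv.swap (1 : Fin 5) 4 * Equiv.swap (1 : Fin 5) 2) ^ 2, finRotate 5 ^ 3 * (Equiv.swap (1 : Fin 5) 3 * Equiv.swap (1 : Fin 5) 4 * Equiv.swap (1 : Fin 5) 2) ^ 2, finRotate 5 ^ 4 * (Equiv.swap (1 : Fin 5) 3 * Equiv.swap (1 : Fin 5) 4 * Equiv.swap (1 : Fin 5) 2) ^ 2, (Equiv.swap (1 : Fin 5) 3 * Equiv.swap (1 : Fin 5) 4 * Equiv.swap (1 : Fin 5) 2) ^ 3, finRotate 5 * (Equiv.swap (1 : Fin 5) 3 * Equiv.swap (1 : Fin 5) 4 * Equiv.swap (1 : Fin 5) 2) ^ 3, finRotate 5 ^ 2 * (Equiv.swap (1 : Fin 5) 3 * Equiv.swap (1 : Fin 5) 4 * Equiv.swap (1 : Fin 5) 2) ^ 3, finRotate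 5 ^ 3 * (Equiv.swap (1 : Fin 5) 3 * Equiv.swap (1 : Fin 5) 4 * Equiv.swap (1 : Fin 5) 2) ^ 3, finRotate 5 ^ 4 * (Equiv.swap (1 : Fin 5) 3 * Equiv.swap (1 : Fin 5) 4 * Equiv.swap (1 : Fin 5) 2) ^ 3} : Finset (Perm (Fin 5))), a⁻¹ ∈ ({1, finRotate 5, finRotate 5 ^ 2, finRotate 5 ^ 3, finRotate 5 ^ 4, (Equiv.swap (1 : Fin 5) 3 * Equiv.swap (1 : Fin 5) 4 * Equiv.swap (1 : Fin 5) 2), finRotate 5 * (Equiv.swap (1 : Fin 5) 3 * Equiv.swap (1 : Fin 5) 4 * Equiv.swap (1 : Fin 5) 2), finRotate 5 ^ 2 * (Equiv.swap (1 : Fin 5) 3 * Equiv.swap (1 : Fin 5) 4 * Equiv.swap (1 : Fin 5) 2), finRotate 5 ^ 3 * (Equiv.swap (1 : Fin 5) 3 * Equiv.swap (1 : Fin 5) 4 * Equiv.swap (1 : Fin 5) 2), finRotate 5 ^ 4 * (Equiv.swap (1 : Fin 5) 3 * Equiv.swap (1 : Fin 5) 4 * Equiv.swap (1 : Fin 5)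 2), (Equiv.swap (1 : Fin 5) 3 * Equiv.swap (1 : Fin 5) 4 * Equiv.swap (1 : Fin 5) 2) ^ 2, finRotate 5 * (Equiv.swap (1 : Fin 5) 3 * Equiv.swap (1 : Fin 5) 4 * Equiv.swap (1 : Fin 5) 2) ^ 2, finRotate 5 ^ 2 * (Equiv.swap (1 : Fin 5) 3 * Equiv.swap (1 : Fin 5) 4 * Equiv.swap (1 : Fin 5) 2) ^ 2, finRotate 5 ^ 3 * (Equiv.swap (1 : Fin 5) 3 * Equiv.swap (1 : Fin 5) 4 * Equiv.swap (1 : Fin 5) 2) ^ 2, finRotate 5 ^ 4 * (Equiv.swap (1 : Fin 5) 3 * Equiv.swap (1 : Fin 5) 4 * Equiv.swap (1 : Fin 5) 2) ^ 2, (Equiv.swap (1 : Fin 5) 3 * Equiv.swap (1 : Fin 5) 4 * Equiv.swap (1 : Fin 5) 2) ^ 3, finRotate 5 * (Equiv.swap (1 : Fin 5) 3 * Equiv.swap (1 : Fin 5) 4 * Equiv.swap (1 : Fin 5) 2) ^ 3, finRotate 5 ^ 2 * (Equiv.swap (1 : Fin 5) 3 * Equiv.swap (1 : Fin 5) 4 *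 Equiv.swap (1 : Fin 5) 2) ^ 3, finRotate 5 ^ 3 * (Equiv.swap (1 : Fin 5) 3 * Equiv.swap (1 : Fin 5) 4 * Equiv.swap (1 : Fin 5) 2) ^ 3, finRotate 5 ^ 4 * (Equiv.swap (1 : Fin 5) 3 * Equiv.swap (1 : Fin 5) 4 * Equiv.swap (1 : Fin 5) 2) ^ 3} : Finset (Perm (Fin 5)))) ∧ (({1, finRotate 5, finRotate 5 ^ 2, finRotate 5 ^ 3, finRotate 5 ^ 4, (Equiv.swap (1 : Fin 5) 3 * Equiv.swap (1 : Fin 5) 4 * Equiv.swap (1 : Fin 5) 2), finRotate 5 * (Equiv.swap (1 : Fin 5) 3 * Equiv.swap (1 : Fin 5) 4 * Equiv.swap (1 : Fin 5) 2), finRotate 5 ^ 2 * (Equiv.swap (1 : Fin 5) 3 * Equiv.swap (1 : Fin 5) 4 * Equiv.swap (1 : Fin 5) 2), finRotate 5 ^ 3 * (Equiv.swap (1 : Fin 5) 3 * Equiv.swap (1 : Fin 5) 4 * Equiv.swap (1 : Fin 5) 2), finRotate 5 ^ 4 * (Equiv.swap (1 : Fin 5) 3 * Equiv.swap (1 : Fin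 5) 4 * Equiv.swap (1 : Fin 5) 2), (Equiv.swap (1 : Fin 5) 3 * Equiv.swap (1 : Fin 5) 4 * Equiv.swap (1 : Fin 5) 2) ^ 2, finRotate 5 * (Equiv.swap (1 : Fin 5) 3 * Equiv.swap (1 : Fin 5) 4 * Equiv.swap (1 : Fin 5) 2) ^ 2, finRotate 5 ^ 2 * (Equiv.swap (1 : Fin 5) 3 * Equiv.swap (1 : Fin 5) 4 * Equiv.swap (1 : Fin 5) 2) ^ 2, finRotate 5 ^ 3 * (Equiv.swap (1 : Fin 5) 3 * Equiv.swap (1 : Fin 5) 4 * Equiv.swap (1 : Fin 5) 2) ^ 2, finRotate 5 ^ 4 * (Equiv.swap (1 : Fin 5) 3 * Equiv.swap (1 : Fin 5) 4 * Equiv.swap (1 : Fin 5) 2) ^ 2, (Equiv.swap (1 : Fin 5) 3 * Equiv.swap (1 : Fin 5) 4 * Equiv.swap (1 : Fin 5) 2) ^ 3, finRotate 5 * (Equiv.swap (1 : Fin 5) 3 * Equiv.swap (1 : Fin 5) 4 * Equiv.swap (1 : Fin 5) 2) ^ 3, finRotate 5 ^ 2 * (Equiv.swap (1 : Fin 5)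 3 * Equiv.swap (1 : Fin 5) 4 * Equiv.swap (1 : Fin 5) 2) ^ 3, finRotate 5 ^ 3 * (Equiv.swap (1 : Fin 5) 3 * Equiv.swap (1 : Fin 5) 4 * Equiv.swap (1 : Fin 5) 2) ^ 3, finRotate 5 ^ 4 * (Equiv.swap (1 : Fin 5) 3 * Equiv.swap (1 : Fin 5) 4 * Equiv.swap (1 : Fin 5) 2) ^ 3} : Finset (Perm (Fin 5)))).card = 20 := by
  refine ⟨by decide, by decide, by decide, by decide⟩

set_option maxRecDepth 8000 in
/-- `#Stab(0) = 24` in `S₅`. -/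
private theorem card_filter_apply_zero_five :
    (Finset.univ.filter fun q : Perm (Fin 5) => q 0 = 0).card = 24 := by decide

/-! ### Assembly -/

/-- From a finset closed under the group operations to a subgroup with the same membership. -/
private theorem exists_subgroup_of_closed' (F : Finset (Perm (Fin 5))) (h1 : (1 : Perm (Fin 5)) ∈ F)
    (hmul : ∀ a ∈ F, ∀ b ∈ F, a * b ∈ F) (hinv : ∀ a ∈ F, a⁻¹ ∈ F) :
    ∃ S : Subgroup (Perm (Fin 5)), Nat.card S = F.card ∧
      ∀ y : Perm (Fin 5), Nat.card {q : Perm (Fin 5) // q * y * q⁻¹ ∈ S} =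
        (Finset.univ.filter fun q : Perm (Fin 5) => q * y * q⁻¹ ∈ F).card := by
  classical
  let S : Subgroup (Perm (Fin 5)) :=
    { carrier := {σ | σ ∈ F}
      mul_mem' := fun {a} {b} ha hb => hmul a ha b hb
      one_mem' := h1
      inv_mem' := fun {a} ha => hinv a ha }
  refine ⟨S, ?_, fun y => ?_⟩
  · have e : S ≃ {q : Perm (Fin 5) // q ∈ F} := Equiv.subtypeEquivRight (fun q => Iff.rfl)
    rw [Nat.card_congr e, Nat.card_eq_fintype_card, Fintype.card_coe]
  · have e : {q : Perm (Fin 5) // q * y * q⁻¹ ∈ S} ≃ {q : Perm (Fin 5) // q * y * q⁻¹ ∈ F} :=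
      Equiv.subtypeEquivRight (fun q => Iff.rfl)
    rw [Nat.card_congr e, Nat.card_eq_fintype_card, Fintype.card_subtype]

/-- The stabiliser of `0` in `S₅`: order `24`, and its conjugation counts are fixed-point tests. -/
private theorem exists_stabilizer_subgroup :
    ∃ S : Subgroup (Perm (Fin 5)), Nat.card S = 24 ∧
      ∀ y : Perm (Fin 5), Nat.card {q : Perm (Fin 5) // q * y * q⁻¹ ∈ S} =
        (Finset.univ.filter fun q : Perm (Fin 5) => (q * y * q⁻¹) 0 = 0).card := by
  classical
  refine ⟨MulAction.stabilizer (Perm (Fin 5)) (0 : Fin 5), ?_, fun y => ?_⟩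
  · have e : MulAction.stabilizer (Perm (Fin 5)) (0 : Fin 5) ≃ {q : Perm (Fin 5) // q 0 = 0} :=
      Equiv.subtypeEquivRight (fun q => MulAction.mem_stabilizer_iff)
    rw [Nat.card_congr e, Nat.card_eq_fintype_card, Fintype.card_subtype, card_filter_apply_zero_five]
  · have e : {q : Perm (Fin 5) // q * y * q⁻¹ ∈ MulAction.stabilizer (Perm (Fin 5)) (0 : Fin 5)} ≃
        {q : Perm (Fin 5) // (q * y * q⁻¹) 0 = 0} :=
      Equiv.subtypeEquivRight (fun q => MulAction.mem_stabilizer_iff)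
    rw [Nat.card_congr e, Nat.card_eq_fintype_card, Fintype.card_subtype]

set_option maxHeartbeats 800000 in
/-- **The one-sided `S₅`-data for the class `(3,2)`.** There are proper subgroups `H₀,…,H₁₀` of `S₅`
(`C₃; C₅ ×2; F₂₀ ×4; Stab(0) ×4`) such that for every `y ∈ S₅`:
`12 ≤ Σ_i Ind_{H_i} 1 (y) + 12·𝟙[#Fix(y) = 0 ∧ #Fix(y²) = 2]`. -/
theorem exists_quintic32_data :
    ∃ H : Fin 11 → Subgroup (Perm (Fin 5)), (∀ i, H i ≠ ⊤) ∧
      ∀ y : Perm (Fin 5), (12 : ℝ) ≤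
        ∑ i, (Nat.card {q : Perm (Fin 5) // q * y * q⁻¹ ∈ H i} : ℝ) / Nat.card (H i) +
          (if (Finset.univ.filter fun i : Fin 5 => y i = i).card = 0 ∧
              (Finset.univ.filter fun i : Fin 5 => (y ^ 2) i = i).card = 2 then (12 : ℝ) else 0) := by
  classical
  obtain ⟨h3one, h3mul, h3inv, h3card⟩ := closed32_C3
  obtain ⟨h5one, h5mul, h5inv, h5card⟩ := closed32_C5
  obtain ⟨h20one, h20mul, h20inv, h20card⟩ := closed32_F20
  obtain ⟨S3, hS3card, hS3c⟩ := exists_subgroup_of_closed' _ h3one h3mul h3inv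
  obtain ⟨S5, hS5card, hS5c⟩ := exists_subgroup_of_closed' _ h5one h5mul h5inv
  obtain ⟨S20, hS20card, hS20c⟩ := exists_subgroup_of_closed' _ h20one h20mul h20inv
  obtain ⟨S24, hS24card, hS24c⟩ := exists_stabilizer_subgroup
  rw [h3card] at hS3card
  rw [h5card] at hS5card
  rw [h20card] at hS20card
  have htop : Nat.card (⊤ : Subgroup (Perm (Fin 5))) = 120 := by
    rw [Subgroup.card_top, Nat.card_eq_fintype_card, Fintype.card_perm, Fintype.card_fin]; rfl
  have hne : ∀ S : Subgroup (Perm (Fin 5)), Nat.card S ≠ 120 → S ≠ ⊤ := by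
    intro S hS h; exact hS (by rw [h, htop])
  -- the family `(C₃, C₅, C₅, F₂₀ ×4, Stab(0) ×4)`
  let G : ℕ → Subgroup (Perm (Fin 5)) := fun k =>
    if k = 0 then S3 else if k ≤ 2 then S5 else if k ≤ 6 then S20 else S24
  let H : Fin 11 → Subgroup (Perm (Fin 5)) := fun i => G i.val
  have hG : ∀ k, G k = S3 ∨ G k = S5 ∨ G k = S20 ∨ G k = S24 := by
    intro k
    show (if k = 0 then S3 else if k ≤ 2 then S5 else if k ≤ 6 then S20 else S24) = S3 ∨
      (if k = 0 then S3 else if k ≤ 2 then S5 else if k ≤ 6 then S20 else S24) = S5 ∨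
      (if k = 0 then S3 else if k ≤ 2 then S5 else if k ≤ 6 then S20 else S24) = S20 ∨
      (if k = 0 then S3 else if k ≤ 2 then S5 else if k ≤ 6 then S20 else S24) = S24
    split_ifs
    · exact Or.inl rfl
    · exact Or.inr (Or.inl rfl)
    · exact Or.inr (Or.inr (Or.inl rfl))
    · exact Or.inr (Or.inr (Or.inr rfl))
  refine ⟨H, fun i => ?_, fun y => ?_⟩
  · rcases hG i.val with h | h | h | h <;> rw [show H i = G i.val from rfl, h]
    · exact hne S3 (by rw [hS3card]; norm_num)
    · exact hne S5 (by rw [hS5card]; norm_num)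
    · exact hne S20 (by rw [hS20card]; norm_num)
    · exact hne S24 (by rw [hS24card]; norm_num)
  · -- expand the sum over `Fin 11` as a sum over `range 11`
    have hexp : ∑ i : Fin 11, (Nat.card {q : Perm (Fin 5) // q * y * q⁻¹ ∈ H i} : ℝ) / Nat.card (H i) =
        ∑ k ∈ Finset.range 11, (Nat.card {q : Perm (Fin 5) // q * y * q⁻¹ ∈ G k} : ℝ) / Nat.card (G k) :=
      Fin.sum_univ_eq_sum_range (fun k => (Nat.card {q : Perm (Fin 5) // q * y * q⁻¹ ∈ G k} : ℝ) /
        Nat.card (G k)) 11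
    rw [hexp]
    have hG0 : G 0 = S3 := rfl
    have hG1 : G 1 = S5 := rfl
    have hG2 : G 2 = S5 := rfl
    have hG3 : G 3 = S20 := rfl
    have hG4 : G 4 = S20 := rfl
    have hG5 : G 5 = S20 := rfl
    have hG6 : G 6 = S20 := rfl
    have hG7 : G 7 = S24 := rfl
    have hG8 : G 8 = S24 := rfl
    have hG9 : G 9 = S24 := rfl
    have hG10 : G 10 = S24 := rfl
    simp only [Finset.sum_range_succ, Finset.sum_range_zero, hG0, hG1, hG2, hG3, hG4, hG5, hG6, hG7,
      hG8, hG9, hG10, hS3card, hS5card, hS20card, hS24card, hS3c, hS5c, hS20c, hS24c]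
    -- reduce to a representative
    obtain ⟨ρ, hρ, hconj⟩ := exists_rep_isConj y
    obtain ⟨c, hc⟩ := isConj_iff.mp hconj
    subst hc
    rw [card_filter_conj_mem_of_conj, card_filter_conj_mem_of_conj, card_filter_conj_mem_of_conj,
      card_filter_conj_of_conj (fun q : Perm (Fin 5) => q 0 = 0), conj_pow, card_filter_fixed_of_conj,
      card_filter_fixed_of_conj]
    simp only [Finset.mem_insert, Finset.mem_singleton] at hρ
    rcases hρ with rfl | rfl | rfl | rfl | rfl | rfl | rfl
    · obtain ⟨e1, e2, e3, e4, e5, e6⟩ := counts32_one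
      rw [e1, e2, e3, e4, e5, e6]; norm_num
    · obtain ⟨e1, e2, e3, e4, e5, e6⟩ := counts32_r2
      rw [e1, e2, e3, e4, e5, e6]; norm_num
    · obtain ⟨e1, e2, e3, e4, e5, e6⟩ := counts32_r3
      rw [e1, e2, e3, e4, e5, e6]; norm_num
    · obtain ⟨e1, e2, e3, e4, e5, e6⟩ := counts32_r4
      rw [e1, e2, e3, e4, e5, e6]; norm_num
    · obtain ⟨e1, e2, e3, e4, e5, e6⟩ := counts32_r5
      rw [e1, e2, e3, e4, e5, e6]; norm_num
    · obtain ⟨e1, e2, e3, e4, e5, e6⟩ := counts32_r22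
      rw [e1, e2, e3, e4, e5, e6]; norm_num
    · obtain ⟨e1, e2, e3, e4, e5, e6⟩ := counts32_r32
      rw [e1, e2, e3, e4, e5, e6]; norm_num

end Summit.QuantumAdvantage.QuantumAdvantage.Theorems.DegreeOnePrimesEscape

end
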